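import Summits.BirchSwinnertonDyer.BirchSwinnertonDyer.Theses.UniversalToricDescent
import Summits.BirchSwinnertonDyer.BirchSwinnertonDyer.Theorems.UniversalToricDescentToricTransportModThreeStubRatDescent
import Summits.BirchSwinnertonDyer.BirchSwinnertonDyer.Theorems.UniversalToricDescentThinCombDefs
import Summits.BirchSwinnertonDyer.BirchSwinnertonDyer.Theorems.UniversalToricDescentThinCombWeakReflection
import Summits.BirchSwinnertonDyer.BirchSwinnertonDyer.Theorems.UniversalToricDescentAdditiveSplitIMCInclusionAtThreeStubCharIdealPrincipal
import Summits.BirchSwinnertonDyer.BirchSwinnertonDyer.Theorems.UniversalToricDescentAdditiveSplitIMCInclusionAtThreeStubFrame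
import Summits.BirchSwinnertonDyer.BirchSwinnertonDyer.Theorems.UniversalToricDescentAdditiveSplitIMCInclusionAtThreeStubTorsionTransfer
import Summits.BirchSwinnertonDyer.BirchSwinnertonDyer.Theorems.UniversalToricDescentThinCombLineValue
import Summits.BirchSwinnertonDyer.BirchSwinnertonDyer.Theorems.UniversalToricDescentThinCombContRigidity
import Summits.BirchSwinnertonDyer.BirchSwinnertonDyer.Theorems.UniversalToricDescentCharIdealVacuity
import Summits.BirchSwinnertonDyer.BirchSwinnertonDyer.Theorems.UniversalToricDescentThinCombNoPseudoNullOfPoitouTate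
import Summits.BirchSwinnertonDyer.BirchSwinnertonDyer.Theorems.UniversalToricDescentToricTransportModThreeNormProfile
import Summits.BirchSwinnertonDyer.BirchSwinnertonDyer.Theorems.SignedBaseChangeAnticyclotomicEisensteinDivisibilityXGrTwoModuleFinite
import Summits.BirchSwinnertonDyer.Rank1Residual.X2.HidaLimitCongruenceAlgebra
import Literature.NumberTheory.EllipticCurves.TwoVariableSelmerDual
import Literature.NumberTheory.EllipticCurves.ZpExtensionSplitPrimeLineThroughPair
import Literature.NumberTheory.EllipticCurves.ToricTwoVariablePAdicLFunctionUpTo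
import Literature.NumberTheory.GaloisCohomology.PoitouTateRestrictedRamificationNaturalAt
import Summits.BirchSwinnertonDyer.BirchSwinnertonDyer.Theorems.EisensteinPrimesPoitouTateShaNaturalAtTC
import Summits.BirchSwinnertonDyer.BirchSwinnertonDyer.Theorems.UniversalToricDescentRatwallThinCombContRigidityUpTo
import Summits.BirchSwinnertonDyer.BirchSwinnertonDyer.Theorems.UniversalToricDescentRatwallThinCombContRigidityUpToTwoGradings
import Summits.BirchSwinnertonDyer.BirchSwinnertonDyer.Theorems.UniversalToricDescentThinCombGroupLikeReflection
import Summits.BirchSwinnertonDyer.BirchSwinnertonDyer.Theorems.UniversalToricDescentThinCombFrameInvolution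
import Literature.NumberTheory.EllipticCurves.IwasawaAlgebraTwoVarGeneratorChange
import Summits.BirchSwinnertonDyer.BirchSwinnertonDyer.Theorems.UniversalToricDescentThinCombFrameSubstMap
import Summits.BirchSwinnertonDyer.BirchSwinnertonDyer.Theorems.UniversalToricDescentThinCombOuterConjCharIdeal
import Summits.BirchSwinnertonDyer.BirchSwinnertonDyer.Theorems.UniversalToricDescentRationalSplitIMCInclusionAtThreeClosedModuloV7
import HarnessLib

/-!
# Line `ratwall_thin_comb` v8 on the RATIONAL WALL `RationalSplitIMCInclusionAtThree` (stmt-BirchSwinnertonDyer-24207) — the crux CLOSED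
# MODULO ITS THREE v8 STUBS ONLY: `hK3` (Hao–Loeffler 2025: ∃ ♯♯-frame with its analytic functional equation), `hK4` = Hao–Lim 2026
# main Thm. (c) in its PRINTED shape `Ch(X_{∅𝔭,nr𝔭′}) = ι·Ch(X_{nr𝔭,∅𝔭′})`, `hK2` (Gu 2025, OPEN: rational thin-comb divisibility);
# and the reduction v8-stub2 ⟹ v7-stub2 by the KERNEL `c`-transport of `X_Gr₂` (helper, `--supports stmt-BirchSwinnertonDyer-24207`;
# cell `pub/bsd-wall`, LEAD `cruxlead-24207` g7)

WHY v8 (LEAD-CENSUS-g7). v7's K4 stub `φ_{A_τ} G ∼ G` (quantified over a complex conjugation `c`, a lift `τ` of `σ ↦ c σ⁻¹ c⁻¹` and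
the frame involution `A_τ`) was the composite of a PRINTED theorem — Hao–Lim 2026, main Thm. (c), `Ch(X_Gr(T)) = Ch(X_Gr(T*)^ι)` — with the
`c`-TRANSPORT of the two-variable Selmer dual («for `E/ℚ` the dual datum `(nr at 𝔭, ∅ at 𝔭′)` is carried back to `(∅ at 𝔭, nr at 𝔭′)` by
`c`», bookkeeping not in print). The transport is now a tree theorem for every `E/ℚ`, imaginary quadratic `K`, prime `p`, generator pair
and complex conjugation: `…ThinComb.OuterConjCharIdeal.charIdeal_XGr₂_eq_map_frameSubst` (p751199; with `…ThinComb.GroupLikeAction`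
p749936 and `…ThinComb.OuterConjSelmer` p750338). This file records the consequence for the line:

* `apply_absGaloisOuterConj_eq_of_not_mem` — the coordinates `κ(θ_c σ)` do not depend on the choice of `c ∈ Γ_ℚ ∖ res(Γ_K)`
  (index two: `c = c₀ · res σ₀`, `θ_{res σ₀}` is inner, `κ` is abelian-valued);
* **`charIdealSymm_of_charIdealInvSymm`** — v8-stub2 (Hao–Lim's printed shape, `ℤ₃`-coefficients, NO `c`, `τ`, `A`) IMPLIES
  v7-stub2 VERBATIM (`φ_{A_τ} G ∼ G` in `R₀⟦T₂⟧⟦T₁⟧` for EVERY admissible `(c, τ, A_τ)`): choose a complex conjugation `c₀` (`c₀² = 1`),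
  `c̄₀ • 𝔭′ = 𝔭` (two places above the split `3` in a quadratic field), `A_τ = −A_{c₀}` (`τ σ = (θ_c σ)⁻¹`, independence of `c`),
  transport `Ch(X_{nr𝔭,∅𝔭′}) = φ_{−A_τ}·Ch(X_{∅𝔭,nr𝔭′})`, compose `φ_{−1} ∘ φ_{−A_τ} = φ_{A_τ}`, read `(g) = φ_{A_τ}(g) ⟹ φ_{A_τ} g ∼ g`,
  and move to `R₀` (`FrameSubstMap.associated_frameSubst_map_toUnr`);
* **`RationalSplitIMCInclusionAtThree_of_toricExistsSymm_of_charIdealInvSymm_of_ratCombDvd`** — the crux BY NAME from the three v8 stubs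
  (the v7 certificate `…ClosedModuloV7` fed with the derived v7-stub2).

So, as of v8: 24207 = research {K2-rat} ⊕ print-adjacent {HL25: K3a♯♯ + K3(iii)} ⊕ print PORT {Hao–Lim (c), conditional on their
hypothesis (b)} ⊕ print {∅}; the kernel-side inventory of the line is empty. HONEST FRAMING: conditional (closure.modulo) on three
statements for which this file is no evidence; credits nothing by itself; no summit statement and no case of BSD is proved; 24207 OPEN.
-/

set_option linter.dupNamespace false
set_option autoImplicit false

noncomputable section

open scoped Classical MatrixGroups

namespace Summit.BirchSwinnertonDyer.BirchSwinnertonDyer.Theorems.UniversalToricDescentRatwallThinCombLine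

open NumberField IsDedekindDomain Field
open Literature.NumberTheory.EllipticCurves Literature.NumberTheory.GaloisRepresentations
open Literature.NumberTheory.EllipticCurves.ModularForms
open Summit.BirchSwinnertonDyer.BirchSwinnertonDyer.Theorems.UniversalToricDescentThinComb

/-- **The coordinates of `θ_c σ` do not depend on `c ∈ Γ_ℚ ∖ res(Γ_K)`** (`[K : ℚ] = 2`): two such `c, c₀` differ by `res σ₀`
(index two), `θ_{c} = θ_{c₀} ∘ (σ₀ · σ₀⁻¹)` and a `ℤ_p`-valued character kills the conjugation. [cite: Washington1997, §13.1] -/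
theorem apply_absGaloisOuterConj_eq_of_not_mem {K : Type} [Field K] [NumberField K] [IsGalois ℚ K] (hK2 : Module.finrank ℚ K = 2) {p : ℕ}
    [Fact p.Prime] (κ : ZpExtension K p) {c c₀ : Field.absoluteGaloisGroup ℚ} (hc : c ∉ Set.range (absGaloisRestrict ℚ K))
    (hc₀ : c₀ ∉ Set.range (absGaloisRestrict ℚ K)) (σ : Field.absoluteGaloisGroup K) :
    κ (Literature.NumberTheory.GaloisRepresentations.absGaloisOuterConj ℚ K c σ) =
      κ (Literature.NumberTheory.GaloisRepresentations.absGaloisOuterConj ℚ K c₀ σ) := by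
  haveI : FiniteDimensional ℚ K := Module.finite_of_finrank_eq_succ hK2
  have hidx : (absGaloisRestrict ℚ K).range.index = 2 := by rw [index_range_absGaloisRestrict_eq_finrank, hK2]
  have hmem : c₀⁻¹ * c ∈ (absGaloisRestrict ℚ K).range := by
    rw [Subgroup.mul_mem_iff_of_index_two hidx]
    exact ⟨fun h ↦ absurd (inv_mem_iff.mp h) hc₀, fun h ↦ absurd h hc⟩
  obtain ⟨σ₀, hσ₀⟩ := hmem
  have hσ₀' : absGaloisRestrict ℚ K σ₀ = c₀⁻¹ * c := hσ₀
  have hc' : c = c₀ * absGaloisRestrict ℚ K σ₀ := by rw [hσ₀', mul_inv_cancel_left]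
  rw [hc', Literature.NumberTheory.GaloisRepresentations.absGaloisOuterConj_mul_apply,
    Literature.NumberTheory.GaloisRepresentations.absGaloisOuterConj_absGaloisRestrict_apply, map_mul, map_mul, map_mul, map_mul,
    map_inv, map_inv, mul_inv_cancel_comm]

/-- **v8-stub2 ⟹ v7-stub2.** Hao–Lim's printed functional equation `Ch_{Λ₂}(X_{∅𝔭,nr𝔭′}) = ι·Ch_{Λ₂}(X_{nr𝔭,∅𝔭′})` (hypothesis `hK4`, the
v8 stub `stub_charIdealInvSymmUpTo2` VERBATIM) implies v7's `stub_charIdealSymmUpTo2` VERBATIM: `φ_{A_τ} G ∼ G` in `R₀⟦T₂⟧⟦T₁⟧` for EVERY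
`c ∈ Γ_ℚ ∖ res(Γ_K)`, lift `τ` of `σ ↦ c σ⁻¹ c⁻¹` and `↑A = frameMatrixOf κ₁ κ₂ γ₁ γ₂ τ`, by the KERNEL `c`-transport
(`OuterConjCharIdeal.charIdeal_XGr₂_eq_map_frameSubst` at a complex conjugation `c₀`, `c̄₀ • 𝔭′ = 𝔭`, `A_τ = −A_{c₀}`,
`φ_{−1} ∘ φ_{−A_τ} = φ_{A_τ}`). [cite: HaoLim2026AlgebraicFE, §1 main Thm. (c) (arXiv:2601.10426)] [cite: Howard2004HeegnerKolyvagin, §2.3]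
[cite: NeukirchSchmidtWingberg2008, (5.3.5)] -/
theorem charIdealSymm_of_charIdealInvSymm
    (hK4 :
        ∀ (W : WeierstrassCurve ℚ) [W.IsElliptic] [W.IsGloballyMinimal] (N : ℕ) [NeZero N] (K : Type) [Field K]
          [NumberField K] (Dt : Literature.NumberTheory.EllipticCurves.ModularForms.ModularParametrizationData W N),
        Summit.BirchSwinnertonDyer.Rank1Residual.Additive.ClassO6 W 3 → W.HasSurjectiveModNGaloisRep 3 →
        W.analyticRank = 1 → W.conductorNorm ℤ = N → IsImaginaryQuadratic K → SatisfiesHeegnerHypothesis N K →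
        ∀ (𝔭 : HeightOneSpectrum (𝓞 K)), ((3 : ℕ) : 𝓞 K) ∈ 𝔭.asIdeal →
          𝔭.asIdeal.ramificationIdx (𝓞 ℚ) = 1 → 𝔭.asIdeal.inertiaDeg (𝓞 ℚ) = 1 →
        ∀ (𝔭' : HeightOneSpectrum (𝓞 K)), ((3 : ℕ) : 𝓞 K) ∈ 𝔭'.asIdeal → 𝔭' ≠ 𝔭 →
        ∀ (κ₁ κ₂ : ZpExtension K 3) (γ₁ γ₂ : Field.absoluteGaloisGroup K)
          [Fact (ZpExtension.IsTopGeneratorPair κ₁ κ₂ γ₁ γ₂)],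
        (∀ v : HeightOneSpectrum (𝓞 K), v ≠ 𝔭 → ∀ 𝔓 ∈ v.primesAbove,
            𝔓.inertia (Field.absoluteGaloisGroup K) ≤ κ₁.kerSubgroup) →
        Module.Finite (IwasawaAlgebra₂ 3) ((W.baseChange K).XGr₂ 3 κ₁ κ₂ 𝔭' γ₁ γ₂) →
        Module.IsTorsion (IwasawaAlgebra₂ 3) ((W.baseChange K).XGr₂ 3 κ₁ κ₂ 𝔭' γ₁ γ₂) →
        Module.Finite (IwasawaAlgebra₂ 3) ((W.baseChange K).XGr₂ 3 κ₁ κ₂ 𝔭 γ₁ γ₂) →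
        Literature.NumberTheory.EllipticCurves.Module.charIdeal (IwasawaAlgebra₂ 3)
            ((W.baseChange K).XGr₂ 3 κ₁ κ₂ 𝔭' γ₁ γ₂) =
          (Literature.NumberTheory.EllipticCurves.Module.charIdeal (IwasawaAlgebra₂ 3)
              ((W.baseChange K).XGr₂ 3 κ₁ κ₂ 𝔭 γ₁ γ₂)).map
            (IwasawaAlgebra₂.frameSubst ℤ_[3] (-1 : GL (Fin 2) ℤ_[3]) :
              PowerSeries (PowerSeries ℤ_[3]) →+* PowerSeries (PowerSeries ℤ_[3]))) :
    ∀ (W : WeierstrassCurve ℚ) [W.IsElliptic] [W.IsGloballyMinimal] (N : ℕ) [NeZero N] (K : Type) [Field K]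
          [NumberField K] (Dt : Literature.NumberTheory.EllipticCurves.ModularForms.ModularParametrizationData W N),
        Summit.BirchSwinnertonDyer.Rank1Residual.Additive.ClassO6 W 3 → W.HasSurjectiveModNGaloisRep 3 →
        W.analyticRank = 1 → W.conductorNorm ℤ = N → IsImaginaryQuadratic K → SatisfiesHeegnerHypothesis N K →
        ∀ (𝔭 : HeightOneSpectrum (𝓞 K)), ((3 : ℕ) : 𝓞 K) ∈ 𝔭.asIdeal →
          𝔭.asIdeal.ramificationIdx (𝓞 ℚ) = 1 → 𝔭.asIdeal.inertiaDeg (𝓞 ℚ) = 1 →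
        ∀ (𝔭' : HeightOneSpectrum (𝓞 K)), ((3 : ℕ) : 𝓞 K) ∈ 𝔭'.asIdeal → 𝔭' ≠ 𝔭 →
        ∀ (κ₁ κ₂ : ZpExtension K 3) (γ₁ γ₂ : Field.absoluteGaloisGroup K)
          [Fact (ZpExtension.IsTopGeneratorPair κ₁ κ₂ γ₁ γ₂)],
        (∀ v : HeightOneSpectrum (𝓞 K), v ≠ 𝔭 → ∀ 𝔓 ∈ v.primesAbove,
            𝔓.inertia (Field.absoluteGaloisGroup K) ≤ κ₁.kerSubgroup) →
        Module.Finite (IwasawaAlgebra₂ 3) ((W.baseChange K).XGr₂ 3 κ₁ κ₂ 𝔭' γ₁ γ₂) →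
        Module.IsTorsion (IwasawaAlgebra₂ 3) ((W.baseChange K).XGr₂ 3 κ₁ κ₂ 𝔭' γ₁ γ₂) →
        ∀ (g : IwasawaAlgebra₂ 3),
          Literature.NumberTheory.EllipticCurves.Module.charIdeal (IwasawaAlgebra₂ 3)
            ((W.baseChange K).XGr₂ 3 κ₁ κ₂ 𝔭' γ₁ γ₂) = Ideal.span {g} →
        ∀ (c : Field.absoluteGaloisGroup ℚ), c ∉ Set.range (absGaloisRestrict ℚ K) →
        ∀ (τ : Field.absoluteGaloisGroup K → Field.absoluteGaloisGroup K),
          (∀ σ, absGaloisRestrict ℚ K (τ σ) = c * (absGaloisRestrict ℚ K σ)⁻¹ * c⁻¹) →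
        ∀ (A : GL (Fin 2) ℤ_[3]), (A : Matrix (Fin 2) (Fin 2) ℤ_[3]) = IwasawaAlgebra₂.frameMatrixOf κ₁ κ₂ γ₁ γ₂ τ →
          letI : Algebra ℤ_[3] (unrIntegers 3) := (Summit.BirchSwinnertonDyer.Rank1Residual.X11b.Halves.toUnr 3).toAlgebra
          Associated (IwasawaAlgebra₂.frameSubst (unrIntegers 3) A
              (PowerSeries.map (PowerSeries.map (Summit.BirchSwinnertonDyer.Rank1Residual.X11b.Halves.toUnr 3)) g))
            (PowerSeries.map (PowerSeries.map (Summit.BirchSwinnertonDyer.Rank1Residual.X11b.Halves.toUnr 3)) g) := by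
  intro W _ _ N _ K _ _ Dt hO6 hsurj hrk hN hK hH 𝔭 h3 hram hdeg 𝔭' h3' hne κ₁ κ₂ γ₁ γ₂ hp hur₁ hfin htors g hg c hc τ hτ A hA
  haveI : NumberField.IsTotallyComplex K := hK.2
  haveI : IsGalois ℚ K := Literature.FieldTheory.Galois.isGalois_of_finrank_eq_two hK.1
  obtain ⟨c₀, hc₀, hc₀2⟩ := Literature.NumberTheory.EllipticCurves.exists_not_mem_range_absGaloisRestrict K (Rat.castHom ℝ)
    NumberField.IsTotallyComplex.isComplex
  have hfin𝔭 : Module.Finite (IwasawaAlgebra₂ 3) ((W.baseChange K).XGr₂ 3 κ₁ κ₂ 𝔭 γ₁ γ₂) :=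
    Summit.BirchSwinnertonDyer.BirchSwinnertonDyer.Theorems.SignedBaseChangeAcDivFinitePiece.xGr₂_module_finite
      (W.baseChange K) 3 κ₁ κ₂ 𝔭
  have hHL := hK4 W N K Dt hO6 hsurj hrk hN hK hH 𝔭 h3 hram hdeg 𝔭' h3' hne κ₁ κ₂ γ₁ γ₂ hur₁ hfin htors hfin𝔭
  -- `c̄₀ • 𝔭′ = 𝔭`
  have hswap : absGaloisQuot ℚ K c₀ • 𝔭' = 𝔭 := by
    have hcbar : absGaloisQuot ℚ K c₀ ≠ 1 := fun h ↦ hc₀ ((absGaloisQuot_eq_one_iff ℚ K c₀).mp h)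
    obtain ⟨σ₀, hσ₀⟩ := Literature.NumberTheory.Automorphic.HeightOneSpectrum.exists_algEquiv_smul_eq ℚ
      (Literature.NumberTheory.NumberFields.under_eq_under_of_natCast_mem K h3' h3)
    have hσ₀ne : σ₀ ≠ 1 := by rintro rfl; exact hne (by rw [← hσ₀, one_smul])
    haveI : FiniteDimensional ℚ K := Module.finite_of_finrank_eq_succ hK.1
    have hcard : Fintype.card (K ≃ₐ[ℚ] K) ≤ 2 := hK.1 ▸ AlgEquiv.card_le
    have hceq : absGaloisQuot ℚ K c₀ = σ₀ := by
      by_contra hne'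
      have h3lt : 2 < Fintype.card (K ≃ₐ[ℚ] K) := by
        rw [← Finset.card_univ]
        exact Finset.two_lt_card_iff.mpr ⟨1, absGaloisQuot ℚ K c₀, σ₀, Finset.mem_univ _, Finset.mem_univ _, Finset.mem_univ _,
          hcbar.symm, hσ₀ne.symm, hne'⟩
      omega
    rw [hceq, hσ₀]
  -- `A_τ = −A_{c₀}`
  have hAc : ((-A : GL (Fin 2) ℤ_[3]) : Matrix (Fin 2) (Fin 2) ℤ_[3]) =
      IwasawaAlgebra₂.frameMatrixOf κ₁ κ₂ γ₁ γ₂ (Literature.NumberTheory.GaloisRepresentations.absGaloisOuterConj ℚ K c₀) := by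
    rw [Units.val_neg, hA]
    ext i j
    fin_cases i <;> fin_cases j <;>
      simp [IwasawaAlgebra₂.frameMatrixOf, FrameInvolution.conjInv_eq hτ] <;>
      exact apply_absGaloisOuterConj_eq_of_not_mem hK.1 _ hc hc₀ _
  have htrans := OuterConjCharIdeal.charIdeal_XGr₂_eq_map_frameSubst W hK 3 κ₁ κ₂ γ₁ γ₂ hc₀2 hswap (-A) hAc
  apply FrameSubstMap.associated_frameSubst_map_toUnr
  have hcomp : ((IwasawaAlgebra₂.frameSubst ℤ_[3] (-1 : GL (Fin 2) ℤ_[3]) :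
        PowerSeries (PowerSeries ℤ_[3]) →+* PowerSeries (PowerSeries ℤ_[3])).comp
      (IwasawaAlgebra₂.frameSubst ℤ_[3] (-A) : PowerSeries (PowerSeries ℤ_[3]) →+* PowerSeries (PowerSeries ℤ_[3]))) =
      (IwasawaAlgebra₂.frameSubst ℤ_[3] A : PowerSeries (PowerSeries ℤ_[3]) →+* PowerSeries (PowerSeries ℤ_[3])) := by
    refine RingHom.ext fun F ↦ ?_
    rw [RingHom.comp_apply, RingHom.coe_coe, RingHom.coe_coe, RingHom.coe_coe, ← IwasawaAlgebra₂.frameSubst_mul, neg_mul_neg,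
      one_mul]
  have hideal : Ideal.span {g} = (Ideal.span {g}).map
      (IwasawaAlgebra₂.frameSubst ℤ_[3] A : PowerSeries (PowerSeries ℤ_[3]) →+* PowerSeries (PowerSeries ℤ_[3])) := by
    rw [← hcomp, ← Ideal.map_map, ← hg, ← htrans, ← hHL]
  rw [Ideal.map_span, Set.image_singleton] at hideal
  exact (Ideal.span_singleton_eq_span_singleton.mp hideal).symm

/-- **The rational wall from its three v8 stubs ALONE**: `hK3` (∃ ♯♯-frame with its analytic functional equation under `φ_{A_τ}`),
`hK4` (Hao–Lim's printed algebraic functional equation `Ch(X_{∅𝔭,nr𝔭′}) = ι·Ch(X_{nr𝔭,∅𝔭′})`), `hK2` (rational comb divisibility);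
the v7 certificate `RationalSplitIMCInclusionAtThree_of_toricExistsSymm_of_charIdealSymm_of_ratCombDvd` fed with
`charIdealSymm_of_charIdealInvSymm hK4`. Conditional; closes nothing by itself.
[cite: HaoLoeffler2025, Thm. 3.5, Thm. 4.9 (arXiv:2405.12611)] [cite: HaoLim2026AlgebraicFE, §1 main Thm. (c) (arXiv:2601.10426)]
[cite: Gu2025FiniteSlopeUniversalRS, Conj. 2.15 (arXiv:2512.01184)] -/
theorem RationalSplitIMCInclusionAtThree_of_toricExistsSymm_of_charIdealInvSymm_of_ratCombDvd
    (hK3 :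
        ∀ (W : WeierstrassCurve ℚ) [W.IsElliptic] [W.IsGloballyMinimal] (N : ℕ) [NeZero N] (K : Type) [Field K]
          [NumberField K] (Dt : Literature.NumberTheory.EllipticCurves.ModularForms.ModularParametrizationData W N),
        Summit.BirchSwinnertonDyer.Rank1Residual.Additive.ClassO6 W 3 → W.HasSurjectiveModNGaloisRep 3 →
        W.analyticRank = 1 → W.conductorNorm ℤ = N → IsImaginaryQuadratic K → SatisfiesHeegnerHypothesis N K →
        ∀ (κ : ZpExtension K 3), κ.IsAnticyclotomic → ∀ (γ : Field.absoluteGaloisGroup K) [Fact (κ.IsTopGenerator γ)]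
          (𝔭 : HeightOneSpectrum (𝓞 K)), ((3 : ℕ) : 𝓞 K) ∈ 𝔭.asIdeal →
          𝔭.asIdeal.ramificationIdx (𝓞 ℚ) = 1 → 𝔭.asIdeal.inertiaDeg (𝓞 ℚ) = 1 →
        ∀ (𝔭' : HeightOneSpectrum (𝓞 K)), ((3 : ℕ) : 𝓞 K) ∈ 𝔭'.asIdeal → 𝔭' ≠ 𝔭 →
        ∀ (ι' : PadicAlgCl 3 ≃+* ℂ), Summit.BirchSwinnertonDyer.BirchSwinnertonDyer.Theorems.SchneiderFree.BranchInducesPrime 3 ι' 𝔭 →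
        ∀ (κ₁ κ₂ : ZpExtension K 3) (γ₁ γ₂ : Field.absoluteGaloisGroup K) (k : ℕ)
          [Fact (ZpExtension.IsTopGeneratorPair κ₁ κ₂ γ₁ γ₂)],
        (∀ v : HeightOneSpectrum (𝓞 K), v ≠ 𝔭 → ∀ 𝔓 ∈ v.primesAbove,
            𝔓.inertia (Field.absoluteGaloisGroup K) ≤ κ₁.kerSubgroup) →
        ZpExtension.pairKer κ₁ κ₂ ≤ κ.kerSubgroup → γ₁ * γ⁻¹ ∈ κ.kerSubgroup → γ₂ * (γ ^ (3 ^ k))⁻¹ ∈ κ.kerSubgroup →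
        ∃ (ΩK' : ℂ) (C X Y : ℂ_[3]) (L₂ : PowerSeries (PowerSeries (unrIntegers 3))),
          ΩK' ≠ 0 ∧ C ≠ 0 ∧ X ≠ 0 ∧ Y ≠ 0 ∧
          IsToricTwoVarLFunctionUpTo₂ C X Y ι' 𝔭 𝔭' κ₁ κ₂ γ₁ γ₂ Dt.f ΩK' L₂ ∧
          ∀ (c : Field.absoluteGaloisGroup ℚ), c ∉ Set.range (absGaloisRestrict ℚ K) →
          ∀ (τ : Field.absoluteGaloisGroup K → Field.absoluteGaloisGroup K),
            (∀ σ, absGaloisRestrict ℚ K (τ σ) = c * (absGaloisRestrict ℚ K σ)⁻¹ * c⁻¹) →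
          ∀ (A : GL (Fin 2) ℤ_[3]), (A : Matrix (Fin 2) (Fin 2) ℤ_[3]) = IwasawaAlgebra₂.frameMatrixOf κ₁ κ₂ γ₁ γ₂ τ →
            letI : Algebra ℤ_[3] (unrIntegers 3) := (Summit.BirchSwinnertonDyer.Rank1Residual.X11b.Halves.toUnr 3).toAlgebra
            Associated (IwasawaAlgebra₂.frameSubst (unrIntegers 3) A L₂) L₂)
    (hK4 :
        ∀ (W : WeierstrassCurve ℚ) [W.IsElliptic] [W.IsGloballyMinimal] (N : ℕ) [NeZero N] (K : Type) [Field K]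
          [NumberField K] (Dt : Literature.NumberTheory.EllipticCurves.ModularForms.ModularParametrizationData W N),
        Summit.BirchSwinnertonDyer.Rank1Residual.Additive.ClassO6 W 3 → W.HasSurjectiveModNGaloisRep 3 →
        W.analyticRank = 1 → W.conductorNorm ℤ = N → IsImaginaryQuadratic K → SatisfiesHeegnerHypothesis N K →
        ∀ (𝔭 : HeightOneSpectrum (𝓞 K)), ((3 : ℕ) : 𝓞 K) ∈ 𝔭.asIdeal →
          𝔭.asIdeal.ramificationIdx (𝓞 ℚ) = 1 → 𝔭.asIdeal.inertiaDeg (𝓞 ℚ) = 1 →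
        ∀ (𝔭' : HeightOneSpectrum (𝓞 K)), ((3 : ℕ) : 𝓞 K) ∈ 𝔭'.asIdeal → 𝔭' ≠ 𝔭 →
        ∀ (κ₁ κ₂ : ZpExtension K 3) (γ₁ γ₂ : Field.absoluteGaloisGroup K)
          [Fact (ZpExtension.IsTopGeneratorPair κ₁ κ₂ γ₁ γ₂)],
        (∀ v : HeightOneSpectrum (𝓞 K), v ≠ 𝔭 → ∀ 𝔓 ∈ v.primesAbove,
            𝔓.inertia (Field.absoluteGaloisGroup K) ≤ κ₁.kerSubgroup) →
        Module.Finite (IwasawaAlgebra₂ 3) ((W.baseChange K).XGr₂ 3 κ₁ κ₂ 𝔭' γ₁ γ₂) →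
        Module.IsTorsion (IwasawaAlgebra₂ 3) ((W.baseChange K).XGr₂ 3 κ₁ κ₂ 𝔭' γ₁ γ₂) →
        Module.Finite (IwasawaAlgebra₂ 3) ((W.baseChange K).XGr₂ 3 κ₁ κ₂ 𝔭 γ₁ γ₂) →
        Literature.NumberTheory.EllipticCurves.Module.charIdeal (IwasawaAlgebra₂ 3)
            ((W.baseChange K).XGr₂ 3 κ₁ κ₂ 𝔭' γ₁ γ₂) =
          (Literature.NumberTheory.EllipticCurves.Module.charIdeal (IwasawaAlgebra₂ 3)
              ((W.baseChange K).XGr₂ 3 κ₁ κ₂ 𝔭 γ₁ γ₂)).map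
            (IwasawaAlgebra₂.frameSubst ℤ_[3] (-1 : GL (Fin 2) ℤ_[3]) :
              PowerSeries (PowerSeries ℤ_[3]) →+* PowerSeries (PowerSeries ℤ_[3])))
    (hK2 :
        ∀ (W : WeierstrassCurve ℚ) [W.IsElliptic] [W.IsGloballyMinimal] (N : ℕ) [NeZero N] (K : Type) [Field K]
          [NumberField K] (Dt : Literature.NumberTheory.EllipticCurves.ModularForms.ModularParametrizationData W N),
        Summit.BirchSwinnertonDyer.Rank1Residual.Additive.ClassO6 W 3 → W.HasSurjectiveModNGaloisRep 3 →
        W.analyticRank = 1 → W.conductorNorm ℤ = N → IsImaginaryQuadratic K → SatisfiesHeegnerHypothesis N K →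
        ∀ (𝔭 : HeightOneSpectrum (𝓞 K)), ((3 : ℕ) : 𝓞 K) ∈ 𝔭.asIdeal →
          𝔭.asIdeal.ramificationIdx (𝓞 ℚ) = 1 → 𝔭.asIdeal.inertiaDeg (𝓞 ℚ) = 1 →
        ∀ (𝔭' : HeightOneSpectrum (𝓞 K)), ((3 : ℕ) : 𝓞 K) ∈ 𝔭'.asIdeal → 𝔭' ≠ 𝔭 →
        ∀ (ι' : PadicAlgCl 3 ≃+* ℂ), Summit.BirchSwinnertonDyer.BirchSwinnertonDyer.Theorems.SchneiderFree.BranchInducesPrime 3 ι' 𝔭 →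
        ∀ (κ₁ κ₂ : ZpExtension K 3) (γ₁ γ₂ : Field.absoluteGaloisGroup K)
          [Fact (ZpExtension.IsTopGeneratorPair κ₁ κ₂ γ₁ γ₂)],
        (∀ v : HeightOneSpectrum (𝓞 K), v ≠ 𝔭 → ∀ 𝔓 ∈ v.primesAbove,
            𝔓.inertia (Field.absoluteGaloisGroup K) ≤ κ₁.kerSubgroup) →
        Module.Finite (IwasawaAlgebra₂ 3) ((W.baseChange K).XGr₂ 3 κ₁ κ₂ 𝔭' γ₁ γ₂) →
        Module.IsTorsion (IwasawaAlgebra₂ 3) ((W.baseChange K).XGr₂ 3 κ₁ κ₂ 𝔭' γ₁ γ₂) →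
        ∀ (g : IwasawaAlgebra₂ 3),
          Literature.NumberTheory.EllipticCurves.Module.charIdeal (IwasawaAlgebra₂ 3)
            ((W.baseChange K).XGr₂ 3 κ₁ κ₂ 𝔭' γ₁ γ₂) = Ideal.span {g} →
        ∀ (ΩK' : ℂ) (C X Y : ℂ_[3]) (L₂ : PowerSeries (PowerSeries (unrIntegers 3))), ΩK' ≠ 0 → C ≠ 0 → X ≠ 0 → Y ≠ 0 →
          IsToricTwoVarLFunctionUpTo₂ C X Y ι' 𝔭 𝔭' κ₁ κ₂ γ₁ γ₂ Dt.f ΩK' L₂ →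
        ThinCombDvdRat (unrIntegers 3) 3
          (PowerSeries.map (PowerSeries.map (Summit.BirchSwinnertonDyer.Rank1Residual.X11b.Halves.toUnr 3)) g) L₂) :
    Summit.BirchSwinnertonDyer.BirchSwinnertonDyer.Theses.UniversalToricDescent.RationalSplitIMCInclusionAtThree :=
  RationalSplitIMCInclusionAtThree_of_toricExistsSymm_of_charIdealSymm_of_ratCombDvd hK3 (charIdealSymm_of_charIdealInvSymm hK4) hK2

end Summit.BirchSwinnertonDyer.BirchSwinnertonDyer.Theorems.UniversalToricDescentRatwallThinCombLine

end
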